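import Summits.HodgeConjecture.CorCM.GaloisThirtyTwoOrderEightInverting
import Summits.HodgeConjecture.CorCM.TwoGroupCyclicEightIndexTwo
import Summits.HodgeConjecture.CorCM.GaloisThirtyTwoQuotientSixteen
import Summits.HodgeConjecture.CorCM.GaloisTwoPowerDescentLemmas
import HarnessLib

/-!
# Degree `32`, the «element of order `8`» branch: a GOOD field whose CM quotient `K^⟨t⟩` is of the second GOOD16 kind is structured

COR-CM (cell `pub-hodgecm2`), binder seat b04 (gen 36), count-neutral own lane «Galois-CM-type classification».  KERNEL ONLY:
theorems; no definition, no named fact, no `sorry`.  `HC_CM` is neither used nor claimed.  ORDER-`32` BASE programme (A7-JUNCTION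
gen-36 addendum), the B2 world.

**THEOREM (`struct_of_order_eight_pullback`).**  `K` Galois CM of degree `32`, GOOD (every primitive CM type nondegenerate), every
involution of `Gal(K/ℚ)` central, `Gal(K/ℚ)` non-abelian; `t ∉ {1, c}` a central involution and `r` of order `8` with `r⁴ ∈ {c, ct}`
and all conjugates in `{r, r⁻¹, rt, r⁻¹t}` — the second alternative of `CorCM/GaloisThirtyTwoQuotientSixteen` for `t`.  Then
STRUCT: `Gal(K/ℚ) = H·E` with `E` central of order `≤ 2` and exponent `2`, `c ∈ H ∖ E`, `H` cyclic or generalised quaternion (in fact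
`Gal ≅ Q₁₆ × C₂` with `c ∈ Q₁₆`).

PROOF.  Apply the quotient test again, to `t' = ct`.  Its first alternative puts `r²` in `{1, c, ct, t}` — absurd.  Its second gives
`r₂` of order `8` with `r₂⁴ ∈ {c, t}` and all conjugates in `{r₂, r₂⁻¹, r₂ct, r₂⁻¹ct}`.  `A = C(r) = {rⁱtʲ}` has index `2`
(`CorCM/TwoGroupInvertedCyclicEightTable`) and an element outside it acts by `r ↦ r⁻¹`, `r t` or `r⁻¹ t`.
* `r₂ ∉ A`: `r₂` itself acts; inversion and inversion·shear force `r₂⁴ = 1`, the shear gives the conjugate `r⁻¹ r₂ r = r₂ t` — not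
  allowed (`CorCM/TwoGroupCyclicEightIndexTwo`, the killers of `CorCM/TwoGroupInvertedCyclicEightTable`).
* `r₂ = rⁱ tʲ ∈ A` (`i` odd, `r₂⁴ = r⁴`), `x ∉ A`: the shear conjugates `r₂` to `r₂ t`, inversion·shear to `r₂⁻¹ t` — killed; inversion
  is allowed and forces `c = r⁴`, `x² = rᵃ tᵇ` with `a ∈ {0, 4}`: `x² = 1` contradicts «involutions central», `x² ∈ {t, r⁴t}` is
  `C₈ ⋊₋₁ C₄` — BAD by the certificates of `CorCM/GaloisThirtyTwoOrderEightInverting` — and `x² = r⁴` is `Q₁₆ × C₂`, structured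
  (`struct_of_inverting_sq_r4`).
* `struct_of_order_eight_pullback_of_central` (appended): the same WITHOUT the hypothesis «all involutions central» — `t` central suffices;
  the leaf `x² = 1` (`D₁₆ × C₂`, `c = r⁴`) is then BAD by `exists_simple_degenerate_inverting_d16c2` instead of absent.

## References

* [Shimura1998] G. Shimura, *Abelian Varieties with Complex Multiplication and Modular Functions*, §6.2 Thm. 3, §8.2 Prop. 26.
* [Kubota1965] T. Kubota, *On the field extension by complex multiplication*, Trans. AMS 118 (1965), §2 and §4 Lemma 2.
* [Rotman1995] J. J. Rotman, *An Introduction to the Theory of Groups*, 4th ed., GTM 148, Thm. 5.46.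
* [Dodson1984] B. Dodson, *The structure of Galois groups of CM-fields*, Trans. AMS 283 (1984), §3.3, §5.2.
-/

noncomputable section

open CategoryTheory CategoryTheory.Limits NumberField
open scoped BigOperators

namespace Summit.HodgeConjecture.CorCM.GaloisModels

open Literature.NumberTheory.ComplexMultiplication
open Literature.AlgebraicGeometry.Motives (AbelianVariety CMType)
open Literature.AlgebraicGeometry.HodgeTheory
open Literature.AlgebraicGeometry.Pohlmann1968
open Summit.HodgeConjecture.CorCM.GaloisRank
open Summit.HodgeConjecture.CorCM.GaloisModels.CyclicEight

section Field

variable {K : Type} [Field K] [NumberField K] [IsCMField K] [IsGalois ℚ K]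

/-- **The «element of order `8`» branch of the order-`32` base.**  `K` Galois CM of degree `32`, GOOD, all involutions of `Gal(K/ℚ)`
central, `Gal(K/ℚ)` non-abelian; `t ∉ {1, c}` a central involution, `r` of order `8` with `r⁴ ∈ {c, ct}` and every conjugate of `r`
in `{r, r⁻¹, rt, r⁻¹t}`.  Then `Gal(K/ℚ) = H·E` with `E` central of exponent `2`, `|E| ≤ 2`, `c ∈ H ∖ E`, `H` cyclic or generalised
quaternion. [cite: Shimura1998, §6.2 Thm. 3 and §8.2 Prop. 26] [cite: Kubota1965, §2 and §4 Lemma 2] [cite: Rotman1995, Thm. 5.46]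
[cite: Dodson1984, §3.3 and §5.2] -/
theorem struct_of_order_eight_pullback (hdeg : Module.finrank ℚ K = 32)
    (hgood : ∀ (Φ : CMType K) (φ : K →+* ℂ), IsPrimitive (ℂ ≃+* ℂ) Φ.1 φ → IsNondegenerate Φ)
    (hinvc : ∀ s : K ≃ₐ[ℚ] K, s * s = 1 → ∀ g : K ≃ₐ[ℚ] K, g * s = s * g)
    (t : K ≃ₐ[ℚ] K) (htt : t * t = 1) (ht1 : t ≠ 1) (htc : t ≠ (IsCMField.complexConj K).restrictScalars ℚ)
    (r : K ≃ₐ[ℚ] K) (hr : orderOf r = 8)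
    (hr4 : r ^ 4 = (IsCMField.complexConj K).restrictScalars ℚ ∨ r ^ 4 = (IsCMField.complexConj K).restrictScalars ℚ * t)
    (hconj : ∀ g : K ≃ₐ[ℚ] K, g * r * g⁻¹ = r ∨ g * r * g⁻¹ = r⁻¹ ∨ g * r * g⁻¹ = r * t ∨ g * r * g⁻¹ = r⁻¹ * t)
    (hnab : ∃ g h : K ≃ₐ[ℚ] K, g * h ≠ h * g) :
    ∃ (H E : Subgroup (K ≃ₐ[ℚ] K)) (k : ℕ), H.IsComplement' E ∧ (IsCMField.complexConj K).restrictScalars ℚ ∈ H ∧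
      (IsCMField.complexConj K).restrictScalars ℚ ∉ E ∧ (∀ e ∈ E, e * e = 1 ∧ ∀ g : K ≃ₐ[ℚ] K, g * e = e * g) ∧
      Nat.card E ≤ 2 ∧ Nat.card H = 2 ^ k ∧ (IsCyclic H ∨ (3 ≤ k ∧ Nonempty (H ≃* QuaternionGroup (2 ^ (k - 2))))) := by
  classical
  set c := (IsCMField.complexConj K).restrictScalars ℚ with hcdef
  have hcc : c * c = 1 := model_complexConj_mul_self (MulEquiv.refl (K ≃ₐ[ℚ] K)) (by simp [hcdef])
  have hc1 : c ≠ 1 := model_complexConj_ne_one (MulEquiv.refl (K ≃ₐ[ℚ] K)) (by simp [hcdef])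
  have hccen : ∀ g : K ≃ₐ[ℚ] K, g * c = c * g := fun g =>
    (model_complexConj_comm (MulEquiv.refl (K ≃ₐ[ℚ] K)) (by simp [hcdef]) g).symm
  have htcen : ∀ g : K ≃ₐ[ℚ] K, g * t = t * g := hinvc t htt
  have hcard : Nat.card (K ≃ₐ[ℚ] K) = 32 := by
    rw [Nat.card_eq_fintype_card, card_model_eq_finrank (MulEquiv.refl (K ≃ₐ[ℚ] K)), hdeg]
  -- powers of `r`
  have hr8 : r ^ 8 = 1 := by rw [← hr]; exact pow_orderOf_eq_one r
  have hr4ne : r ^ 4 ≠ 1 := fun h => by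
    have := orderOf_dvd_of_pow_eq_one h; rw [hr] at this; omega
  have hr44 : r ^ 4 * r ^ 4 = 1 := by rw [← pow_add]; exact hr8
  have hsq_ne : ∀ e : K ≃ₐ[ℚ] K, e * e = 1 → r * r ≠ e := fun e he h => hr4ne (by
    rw [show r ^ 4 = (r * r) * (r * r) by simp only [pow_succ, pow_zero, one_mul, mul_assoc], h, he])
  have hrt : r * t = t * r := htcen r
  have htr : t ∉ Subgroup.zpowers r := by
    intro h
    have ht4 : t = r ^ 4 := involution_eq_of_mem_zpowers (m := 3) (by rw [hr]; norm_num) h htt ht1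
      (Subgroup.pow_mem _ (Subgroup.mem_zpowers r) 4) hr44 hr4ne
    rcases hr4 with h4 | h4
    · exact htc (ht4.trans h4)
    · have : c * t = 1 * t := by rw [one_mul, ← h4, ← ht4]
      exact hc1 (mul_right_cancel this)
  -- the central involution `c t`
  have hctct : c * t * (c * t) = 1 := by
    calc c * t * (c * t) = c * (t * c) * t := by simp only [mul_assoc]
      _ = c * (c * t) * t := by rw [hccen t]
      _ = (c * c) * (t * t) := by simp only [mul_assoc]
      _ = 1 := by rw [hcc, htt, one_mul]
  have hct1 : c * t ≠ 1 := fun h => htc (by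
    have : t = c⁻¹ := eq_inv_of_mul_eq_one_right h
    rw [this]; exact inv_eq_of_mul_eq_one_right hcc)
  have hctc : c * t ≠ c := fun h => ht1 (mul_left_cancel (h.trans (mul_one c).symm))
  have hctcen : ∀ g : K ≃ₐ[ℚ] K, g * (c * t) = c * t * g := fun g => by
    rw [← mul_assoc, hccen g, mul_assoc, htcen g, ← mul_assoc]
  have htct : t ≠ c * t := fun h => hc1 (by
    have : c * t = 1 * t := by rw [one_mul]; exact h.symm
    exact mul_right_cancel this)
  have htct' : t * (c * t) = c * t * t := by rw [← mul_assoc, htcen c]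
  -- the quotient test at `c t`
  rcases sq_mem_or_exists_order_eight_of_central_involution hdeg hgood (c * t) hctct hct1 hctc hctcen with
    halt | ⟨r₂, hr₂, hr₂4, hconj₂⟩
  · exfalso
    rcases halt r with h | h | h | h
    · exact hsq_ne 1 (mul_one 1) h
    · exact hsq_ne c hcc h
    · exact hsq_ne (c * t) hctct h
    · rw [← mul_assoc, hcc, one_mul] at h
      exact hsq_ne t htt h
  have hcct : c * (c * t) = t := by rw [← mul_assoc, hcc, one_mul]
  rw [hcct] at hr₂4
  have hr₂4ne : r₂ ^ 4 ≠ 1 := fun h => by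
    have := orderOf_dvd_of_pow_eq_one h; rw [hr₂] at this; omega
  have hr₂t : r₂ * t = t * r₂ := htcen r₂
  by_cases hcomm₂ : r₂ * r = r * r₂
  · /- CASE A: `r₂ ∈ C(r) = {rⁱ tʲ}` -/
    obtain ⟨x, hx⟩ := exists_not_comm_of_order_eight hcard hr htr htcen hnab
    have hxt : x * t = t * x := htcen x
    obtain ⟨i, j, -, -, hr₂eq⟩ := exists_pow_mul_pow_of_comm hcard hr htr hrt hx r₂ hcomm₂
    obtain ⟨hiodd, h4eq⟩ := pow_four_eq_of_comm hr8 htt hrt i j (by rw [← hr₂eq]; exact hr₂4ne)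
    rw [← hr₂eq] at h4eq
    -- the action of `x` on `r`
    have hxconj : x * r * x⁻¹ = r⁻¹ ∨ x * r * x⁻¹ = r * t ∨ x * r * x⁻¹ = r⁻¹ * t := by
      rcases hconj x with h | h | h | h
      · exfalso; apply hx
        calc x * r = x * r * x⁻¹ * x := by rw [inv_mul_cancel_right]
          _ = r * x := by rw [h]
      · exact Or.inl h
      · exact Or.inr (Or.inl h)
      · exact Or.inr (Or.inr h)
    rcases hxconj with hθ | hθ | hθ
    · /- inversion: `c = r⁴`, then by `x²` -/
      have hc4 : c = r ^ 4 := by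
        rcases hr₂4 with h | h
        · exact h.symm.trans h4eq
        · exfalso; apply htr
          rw [h.symm.trans h4eq]
          exact Subgroup.pow_mem _ (Subgroup.mem_zpowers r) 4
      have hxr : x * r = r⁻¹ * x := by rw [← hθ, inv_mul_cancel_right]
      have hxA : ∀ i j : ℕ, r ^ i * t ^ j * x ≠ 1 := by
        intro i j h
        apply hx
        have hxeq : x = (r ^ i * t ^ j)⁻¹ := eq_inv_of_mul_eq_one_right h
        rw [hxeq]
        exact ((((Commute.refl r).pow_left i).mul_left ((show Commute t r from hrt.symm).pow_left j)).inv_left).eq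
      obtain ⟨a, b, ha, hb, hxx⟩ := sq_eq_of_inv hcard hr htt htr hrt hθ hxt
      have hc4' : (IsCMField.complexConj K).restrictScalars ℚ = r ^ 4 := by rw [← hcdef]; exact hc4
      rcases ha with rfl | rfl <;> interval_cases b
      · -- `x² = 1`: a non-central involution
        exfalso
        simp only [pow_zero, mul_one] at hxx
        exact hx ((hinvc x hxx r).symm)
      · -- `x² = t`: `C₈ ⋊₋₁ C₄`, BAD
        exfalso
        simp only [pow_zero, pow_one, one_mul] at hxx
        obtain ⟨Φ, φ, X, ι, ϑ, H1, H2, -⟩ :=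
          exists_simple_degenerate_inverting_sq_t hdeg r t x hr htt htr hrt hxr hxt hxA hc4' hxx
        exact H2 (hgood Φ φ H1)
      · -- `x² = r⁴`: `Q₁₆ × C₂`, structured
        simp only [pow_zero, mul_one] at hxx
        exact struct_of_inverting_sq_r4 hdeg r t x hr htt htr hrt hxr hxt hxA hc4' hxx htcen
      · -- `x² = r⁴ t`: `C₈ ⋊₋₁ C₄` again, BAD
        exfalso
        simp only [pow_one] at hxx
        obtain ⟨Φ, φ, X, ι, ϑ, H1, H2, -⟩ :=
          exists_simple_degenerate_inverting_sq_r4t hdeg r t x hr htt htr hrt hxr hxt hxA hc4' hxx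
        exact H2 (hgood Φ φ H1)
    · /- shear: `x r₂ x⁻¹ = r₂ t` is not an allowed conjugate -/
      exfalso
      have h1 : x * r₂ * x⁻¹ = r₂ * t := by
        rw [hr₂eq, conj_of_shear hrt hθ hxt i j, invol_pow_odd htt hiodd]
      exact not_allowed_of_eq_mul h1 ht1 htct htt hctct htct' hr₂4ne (hconj₂ x)
    · /- inversion·shear: `x r₂ x⁻¹ = r₂⁻¹ t` is not an allowed conjugate -/
      exfalso
      have h1 : x * r₂ * x⁻¹ = r₂⁻¹ * t := by
        rw [hr₂eq, conj_of_invshear htt hrt hθ hxt i j, invol_pow_odd htt hiodd]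
      exact not_allowed_of_eq_inv_mul h1 ht1 htct htt hctct htct' hr₂4ne (hconj₂ x)
  · /- CASE B: `r₂` itself acts on `r` -/
    exfalso
    rcases hconj r₂ with h | h | h | h
    · apply hcomm₂
      calc r₂ * r = r₂ * r * r₂⁻¹ * r₂ := by rw [inv_mul_cancel_right]
        _ = r * r₂ := by rw [h]
    · exact hr₂4ne (pow_four_eq_one_of_inv hcard hr htt htr hrt h hr₂t)
    · have h1 : r⁻¹ * r₂ * r⁻¹⁻¹ = r₂ * t := conj_eq_mul_of_shear h hr₂t
      exact not_allowed_of_eq_mul h1 ht1 htct htt hctct htct' hr₂4ne (hconj₂ r⁻¹)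
    · exact hr₂4ne (pow_four_eq_one_of_invshear hcard hr htt htr hrt h hr₂t)

/-- **The «element of order `8`» branch WITHOUT «involutions central».**  `K` Galois CM of degree `32`, GOOD, `Gal(K/ℚ)` non-abelian; `t ∉ {1, c}` a central involution, `r` of order `8` with `r⁴ ∈ {c, ct}` and every conjugate of `r`
in `{r, r⁻¹, rt, r⁻¹t}`.  Then `Gal(K/ℚ) = H·E` with `E` central of exponent `2`, `|E| ≤ 2`, `c ∈ H ∖ E`, `H` cyclic or generalised
quaternion — the only leaf with a non-central involution, `D₁₆ × C₂` (`x² = 1`), being BAD by the certificate of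
`CorCM/GaloisThirtyTwoOrderEightInverting`. [cite: Shimura1998, §6.2 Thm. 3 and §8.2 Prop. 26] [cite: Kubota1965, §2 and §4 Lemma 2]
[cite: Rotman1995, Thm. 5.46] [cite: Dodson1984, §3.3 and §5.2] -/
theorem struct_of_order_eight_pullback_of_central (hdeg : Module.finrank ℚ K = 32)
    (hgood : ∀ (Φ : CMType K) (φ : K →+* ℂ), IsPrimitive (ℂ ≃+* ℂ) Φ.1 φ → IsNondegenerate Φ)
    (t : K ≃ₐ[ℚ] K) (htt : t * t = 1) (ht1 : t ≠ 1) (htc : t ≠ (IsCMField.complexConj K).restrictScalars ℚ)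
    (htcen : ∀ g : K ≃ₐ[ℚ] K, g * t = t * g)
    (r : K ≃ₐ[ℚ] K) (hr : orderOf r = 8)
    (hr4 : r ^ 4 = (IsCMField.complexConj K).restrictScalars ℚ ∨ r ^ 4 = (IsCMField.complexConj K).restrictScalars ℚ * t)
    (hconj : ∀ g : K ≃ₐ[ℚ] K, g * r * g⁻¹ = r ∨ g * r * g⁻¹ = r⁻¹ ∨ g * r * g⁻¹ = r * t ∨ g * r * g⁻¹ = r⁻¹ * t)
    (hnab : ∃ g h : K ≃ₐ[ℚ] K, g * h ≠ h * g) :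
    ∃ (H E : Subgroup (K ≃ₐ[ℚ] K)) (k : ℕ), H.IsComplement' E ∧ (IsCMField.complexConj K).restrictScalars ℚ ∈ H ∧
      (IsCMField.complexConj K).restrictScalars ℚ ∉ E ∧ (∀ e ∈ E, e * e = 1 ∧ ∀ g : K ≃ₐ[ℚ] K, g * e = e * g) ∧
      Nat.card E ≤ 2 ∧ Nat.card H = 2 ^ k ∧ (IsCyclic H ∨ (3 ≤ k ∧ Nonempty (H ≃* QuaternionGroup (2 ^ (k - 2))))) := by
  classical
  set c := (IsCMField.complexConj K).restrictScalars ℚ with hcdef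
  have hcc : c * c = 1 := model_complexConj_mul_self (MulEquiv.refl (K ≃ₐ[ℚ] K)) (by simp [hcdef])
  have hc1 : c ≠ 1 := model_complexConj_ne_one (MulEquiv.refl (K ≃ₐ[ℚ] K)) (by simp [hcdef])
  have hccen : ∀ g : K ≃ₐ[ℚ] K, g * c = c * g := fun g =>
    (model_complexConj_comm (MulEquiv.refl (K ≃ₐ[ℚ] K)) (by simp [hcdef]) g).symm
  have hcard : Nat.card (K ≃ₐ[ℚ] K) = 32 := by
    rw [Nat.card_eq_fintype_card, card_model_eq_finrank (MulEquiv.refl (K ≃ₐ[ℚ] K)), hdeg]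
  -- powers of `r`
  have hr8 : r ^ 8 = 1 := by rw [← hr]; exact pow_orderOf_eq_one r
  have hr4ne : r ^ 4 ≠ 1 := fun h => by
    have := orderOf_dvd_of_pow_eq_one h; rw [hr] at this; omega
  have hr44 : r ^ 4 * r ^ 4 = 1 := by rw [← pow_add]; exact hr8
  have hsq_ne : ∀ e : K ≃ₐ[ℚ] K, e * e = 1 → r * r ≠ e := fun e he h => hr4ne (by
    rw [show r ^ 4 = (r * r) * (r * r) by simp only [pow_succ, pow_zero, one_mul, mul_assoc], h, he])
  have hrt : r * t = t * r := htcen r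
  have htr : t ∉ Subgroup.zpowers r := by
    intro h
    have ht4 : t = r ^ 4 := involution_eq_of_mem_zpowers (m := 3) (by rw [hr]; norm_num) h htt ht1
      (Subgroup.pow_mem _ (Subgroup.mem_zpowers r) 4) hr44 hr4ne
    rcases hr4 with h4 | h4
    · exact htc (ht4.trans h4)
    · have : c * t = 1 * t := by rw [one_mul, ← h4, ← ht4]
      exact hc1 (mul_right_cancel this)
  -- the central involution `c t`
  have hctct : c * t * (c * t) = 1 := by
    calc c * t * (c * t) = c * (t * c) * t := by simp only [mul_assoc]
      _ = c * (c * t) * t := by rw [hccen t]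
      _ = (c * c) * (t * t) := by simp only [mul_assoc]
      _ = 1 := by rw [hcc, htt, one_mul]
  have hct1 : c * t ≠ 1 := fun h => htc (by
    have : t = c⁻¹ := eq_inv_of_mul_eq_one_right h
    rw [this]; exact inv_eq_of_mul_eq_one_right hcc)
  have hctc : c * t ≠ c := fun h => ht1 (mul_left_cancel (h.trans (mul_one c).symm))
  have hctcen : ∀ g : K ≃ₐ[ℚ] K, g * (c * t) = c * t * g := fun g => by
    rw [← mul_assoc, hccen g, mul_assoc, htcen g, ← mul_assoc]
  have htct : t ≠ c * t := fun h => hc1 (by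
    have : c * t = 1 * t := by rw [one_mul]; exact h.symm
    exact mul_right_cancel this)
  have htct' : t * (c * t) = c * t * t := by rw [← mul_assoc, htcen c]
  -- the quotient test at `c t`
  rcases sq_mem_or_exists_order_eight_of_central_involution hdeg hgood (c * t) hctct hct1 hctc hctcen with
    halt | ⟨r₂, hr₂, hr₂4, hconj₂⟩
  · exfalso
    rcases halt r with h | h | h | h
    · exact hsq_ne 1 (mul_one 1) h
    · exact hsq_ne c hcc h
    · exact hsq_ne (c * t) hctct h
    · rw [← mul_assoc, hcc, one_mul] at h
      exact hsq_ne t htt h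
  have hcct : c * (c * t) = t := by rw [← mul_assoc, hcc, one_mul]
  rw [hcct] at hr₂4
  have hr₂4ne : r₂ ^ 4 ≠ 1 := fun h => by
    have := orderOf_dvd_of_pow_eq_one h; rw [hr₂] at this; omega
  have hr₂t : r₂ * t = t * r₂ := htcen r₂
  by_cases hcomm₂ : r₂ * r = r * r₂
  · /- CASE A: `r₂ ∈ C(r) = {rⁱ tʲ}` -/
    obtain ⟨x, hx⟩ := exists_not_comm_of_order_eight hcard hr htr htcen hnab
    have hxt : x * t = t * x := htcen x
    obtain ⟨i, j, -, -, hr₂eq⟩ := exists_pow_mul_pow_of_comm hcard hr htr hrt hx r₂ hcomm₂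
    obtain ⟨hiodd, h4eq⟩ := pow_four_eq_of_comm hr8 htt hrt i j (by rw [← hr₂eq]; exact hr₂4ne)
    rw [← hr₂eq] at h4eq
    -- the action of `x` on `r`
    have hxconj : x * r * x⁻¹ = r⁻¹ ∨ x * r * x⁻¹ = r * t ∨ x * r * x⁻¹ = r⁻¹ * t := by
      rcases hconj x with h | h | h | h
      · exfalso; apply hx
        calc x * r = x * r * x⁻¹ * x := by rw [inv_mul_cancel_right]
          _ = r * x := by rw [h]
      · exact Or.inl h
      · exact Or.inr (Or.inl h)
      · exact Or.inr (Or.inr h)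
    rcases hxconj with hθ | hθ | hθ
    · /- inversion: `c = r⁴`, then by `x²` -/
      have hc4 : c = r ^ 4 := by
        rcases hr₂4 with h | h
        · exact h.symm.trans h4eq
        · exfalso; apply htr
          rw [h.symm.trans h4eq]
          exact Subgroup.pow_mem _ (Subgroup.mem_zpowers r) 4
      have hxr : x * r = r⁻¹ * x := by rw [← hθ, inv_mul_cancel_right]
      have hxA : ∀ i j : ℕ, r ^ i * t ^ j * x ≠ 1 := by
        intro i j h
        apply hx
        have hxeq : x = (r ^ i * t ^ j)⁻¹ := eq_inv_of_mul_eq_one_right h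
        rw [hxeq]
        exact ((((Commute.refl r).pow_left i).mul_left ((show Commute t r from hrt.symm).pow_left j)).inv_left).eq
      obtain ⟨a, b, ha, hb, hxx⟩ := sq_eq_of_inv hcard hr htt htr hrt hθ hxt
      have hc4' : (IsCMField.complexConj K).restrictScalars ℚ = r ^ 4 := by rw [← hcdef]; exact hc4
      rcases ha with rfl | rfl <;> interval_cases b
      · -- `x² = 1`: `D₁₆ × C₂`, BAD
        exfalso
        simp only [pow_zero, mul_one] at hxx
        obtain ⟨Φ, φ, X, ι, ϑ, H1, H2, -⟩ :=
          exists_simple_degenerate_inverting_d16c2 hdeg r t x hr htt htr hrt hxr hxt hxA hc4' hxx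
        exact H2 (hgood Φ φ H1)
      · -- `x² = t`: `C₈ ⋊₋₁ C₄`, BAD
        exfalso
        simp only [pow_zero, pow_one, one_mul] at hxx
        obtain ⟨Φ, φ, X, ι, ϑ, H1, H2, -⟩ :=
          exists_simple_degenerate_inverting_sq_t hdeg r t x hr htt htr hrt hxr hxt hxA hc4' hxx
        exact H2 (hgood Φ φ H1)
      · -- `x² = r⁴`: `Q₁₆ × C₂`, structured
        simp only [pow_zero, mul_one] at hxx
        exact struct_of_inverting_sq_r4 hdeg r t x hr htt htr hrt hxr hxt hxA hc4' hxx htcen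
      · -- `x² = r⁴ t`: `C₈ ⋊₋₁ C₄` again, BAD
        exfalso
        simp only [pow_one] at hxx
        obtain ⟨Φ, φ, X, ι, ϑ, H1, H2, -⟩ :=
          exists_simple_degenerate_inverting_sq_r4t hdeg r t x hr htt htr hrt hxr hxt hxA hc4' hxx
        exact H2 (hgood Φ φ H1)
    · /- shear: `x r₂ x⁻¹ = r₂ t` is not an allowed conjugate -/
      exfalso
      have h1 : x * r₂ * x⁻¹ = r₂ * t := by
        rw [hr₂eq, conj_of_shear hrt hθ hxt i j, invol_pow_odd htt hiodd]
      exact not_allowed_of_eq_mul h1 ht1 htct htt hctct htct' hr₂4ne (hconj₂ x)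
    · /- inversion·shear: `x r₂ x⁻¹ = r₂⁻¹ t` is not an allowed conjugate -/
      exfalso
      have h1 : x * r₂ * x⁻¹ = r₂⁻¹ * t := by
        rw [hr₂eq, conj_of_invshear htt hrt hθ hxt i j, invol_pow_odd htt hiodd]
      exact not_allowed_of_eq_inv_mul h1 ht1 htct htt hctct htct' hr₂4ne (hconj₂ x)
  · /- CASE B: `r₂` itself acts on `r` -/
    exfalso
    rcases hconj r₂ with h | h | h | h
    · apply hcomm₂
      calc r₂ * r = r₂ * r * r₂⁻¹ * r₂ := by rw [inv_mul_cancel_right]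
        _ = r * r₂ := by rw [h]
    · exact hr₂4ne (pow_four_eq_one_of_inv hcard hr htt htr hrt h hr₂t)
    · have h1 : r⁻¹ * r₂ * r⁻¹⁻¹ = r₂ * t := conj_eq_mul_of_shear h hr₂t
      exact not_allowed_of_eq_mul h1 ht1 htct htt hctct htct' hr₂4ne (hconj₂ r⁻¹)
    · exact hr₂4ne (pow_four_eq_one_of_invshear hcard hr htt htr hrt h hr₂t)

end Field

end Summit.HodgeConjecture.CorCM.GaloisModels

end
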